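import Summits.Ventures.YMGap.RobustBall.BoundaryDecay
import Summits.Ventures.YMGap.RobustBall.UniformMassGapKR
import HarnessLib

/-!
# Venture YMGap, track ROBUST-BALL — ONE STATE AT A RATE, step 2: boundary insensitivity UNIFORMLY on the tier-1 ball,
# `SU(2)` hypothesis-free, every `N` (Bakry–Émery), named cells and the Wilson point

HONEST FRAMING. WHAT THIS IS: a venture file (cell `pub-ymgap`, track Y2 ROBUST-BALL, seat ds-3, theorems only) feeding
the carrier theorem `abs_boundary_sub_integral_le_of_isKRContraction` of `BoundaryDecay.lean` with the landed one-link
doors, exactly as `UniformMassGapKR.lean` feeds the clustering currency: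
* `abs_boundary_sub_integral_le_of_pair` — for `d, N ≥ 1`, a Poincaré/variance pair `(c, v)` on `‖B‖_op ≤ b ⊇ 2(d−1)|β|`
  and `6(d−1)|β| e^{ε₀} √(c v) + e^{ε₀/2} √c ε₁ ≤ ρ < 1`: for EVERY member of `MemBallZd ε₀ ε₁ R`, every DLR state `μ`,
  every finite link volume `Λ`, every boundary field `η`, every Lipschitz cylinder `F` (constant `K`, links `Δ` at depth
  `≥ D` in `Λ`): `|∫ F dγ^W_Λ(·|η) − ∫ F dμ| ≤ 2√N · K · #Δ · max(ρ,½)^{⌊D/max(1,R)⌋₊}` — member-independent constants;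
* `SU(2)`, every `d`, HYPOTHESIS-FREE (sharp Poincaré constant `2/3`): `2(d−1)|β_W| e^{ε₀} + e^{ε₀/2} √(2/3) ε₁ ≤ ρ < 1`
  (`su2_abs_boundary_sub_integral_le[_dim4]`), the clean exponential reading for `1/2 ≤ ρ < 1`, `D ≥ 0`:
  `≤ 4√2 · K · #Δ · e^{−((1−ρ)/max(1,R)) D}` (`su2_abs_boundary_sub_integral_le_dim4_exp`); numeric rows on the
  one-parameter ball `(2ε, ε)` (`su2_boundaryRowA`) and the cells `(β_W, ε; ρ) = (1/8, 1/20; 7/8)`, `(1/10, 1/10; 7/8)`,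
  `(1/16, 1/20; 1/2)`;
* THE WILSON POINT (`su2_wilson_boundary_upTo_oneTwelfth`): for `0 ≤ β_W ≤ 1/12` every DLR state `μ` of `SU(2)` lattice
  Yang–Mills on `ℤ⁴` and every finite-volume Wilson distribution `γ_Λ(· | η)` with ANY boundary field satisfy
  `|∫ F dγ_Λ(·|η) − ∫ F dμ| ≤ 2√2 · K · #Δ · 2^{−⌊D⌋₊}`; for `1/12 ≤ β_W < 1/6`: `(6β_W)^{⌊D⌋₊}`;
* every `N ≥ 2`, hypothesis-free, Bakry–Émery pair (`suN_abs_boundary_sub_integral_le_bakryEmery`).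
WHAT THIS IS NOT: the depth rate is the Dobrushin-comparison lower bound (vanishing linearly at the door's threshold,
divided by the range); strong-coupling LATTICE statements, nothing about the continuum limit or the Clay problem.

References: H. Föllmer, LNM 1362 (1988), Ch. I, (2.8), (2.10); H.-O. Georgii (2011), Remark 8.26; the track's
`BoundaryDecay.lean`, `UniformMassGapKR.lean`, `MassGapOnBall.lean`, `RowsSU2.lean`.
-/

noncomputable section

open MeasureTheory Filter Function ProbabilityTheory Real
open scoped NNReal
open Literature.Probability.LatticeModels
open Literature.Probability.LatticeModels.DobrushinMetric
open Literature.MathematicalPhysics.QuantumLattice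
open Literature.MathematicalPhysics.QuantumFieldTheory hiding ZdEdge
open Summit.QuantumFields.BalabanUV.InfraRed.StrongCouplingPoincareDoorSUN (oneLinkPoincareSUN_two_sharp
  oneLinkPoincareSUN_bakryEmery)
open Summit.QuantumFields.BalabanUV.InfraRed.StrongCouplingVarianceDoorSUN (oneLinkVarianceBound_bakryEmery)

namespace Summit.Ventures.YMGap.RobustBall

variable {d N : ℕ}

/-! ### The ball: uniform boundary insensitivity from a one-link pair -/

/-- **BOUNDARY INSENSITIVITY UNIFORMLY ON THE TIER-1 BALL from a one-link pair.** For `d, N ≥ 1`, a 't Hooft coupling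
`β`, a Poincaré/variance pair `(c, v)` of the unperturbed `SU(N)` one-link family on `‖B‖_op ≤ b`, `b ≥ 2(d−1)|β|`, and
`6(d−1)|β| e^{ε₀} √(c v) + e^{ε₀/2} √c ε₁ ≤ ρ < 1`: for EVERY member `(W, supp)` of `MemBallZd ε₀ ε₁ R`, every DLR state
`μ` of the member, every finite link volume `Λ`, every boundary field `η` and every Lipschitz cylinder `F` (constant `K`,
links `Δ` at depth `≥ D` in `Λ`): `|∫ F dγ^W_Λ(· | η) − ∫ F dμ| ≤ 2√N · K · #Δ · max(ρ,½)^{⌊D / max(1,R)⌋₊}` — the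
constants do not depend on the member (`isKRContraction_perturbedYM_SU`, `sum_perturbedNbr_coeff_le`). [folklore] -/
theorem abs_boundary_sub_integral_le_of_pair (hd : 1 ≤ d) (hN : 1 ≤ N) {β b c v ε₀ ε₁ ρ R : ℝ} (hc : 0 ≤ c)
    (hv : 0 ≤ v) (hb : |β| * (2 * ((d : ℝ) - 1)) ≤ b)
    (hP : ∀ B : Matrix (Fin N) (Fin N) ℂ, matrixOpNorm B ≤ b →
      ∀ (ψ : Matrix.specialUnitaryGroup (Fin N) ℂ → ℝ) (M : ℝ), 0 ≤ M →
        (∀ x y, |ψ x - ψ y| ≤ M * suFrobDist x y) →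
        Var[ψ; (haarProbability (Matrix.specialUnitaryGroup (Fin N) ℂ)).tilted
          fun g => (N : ℝ) * ((g : Matrix (Fin N) (Fin N) ℂ) * B).trace.re] ≤ c * M ^ 2)
    (hVB : ∀ B : Matrix (Fin N) (Fin N) ℂ, matrixOpNorm B ≤ b → ∀ Δ : Matrix (Fin N) (Fin N) ℂ,
      Var[fun g : Matrix.specialUnitaryGroup (Fin N) ℂ =>
          (N : ℝ) * ((g : Matrix (Fin N) (Fin N) ℂ) * Δ).trace.re;
        (haarProbability (Matrix.specialUnitaryGroup (Fin N) ℂ)).tilted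
          fun g => (N : ℝ) * ((g : Matrix (Fin N) (Fin N) ℂ) * B).trace.re] ≤ v * frobNorm Δ ^ 2)
    (hρ : 6 * ((d : ℝ) - 1) * |β| * (exp ε₀ * Real.sqrt (c * v)) + exp (ε₀ / 2) * Real.sqrt c * ε₁ ≤ ρ)
    (hρ1 : ρ < 1) {W : Potential (ZdEdge d) (Matrix.specialUnitaryGroup (Fin N) ℂ)}
    {supp : Finset (ZdEdge d) → Finset (Finset (ZdEdge d))} (hmem : MemBallZd ε₀ ε₁ R W supp)
    {μ : Measure (LGConfig d (Matrix.specialUnitaryGroup (Fin N) ℂ))}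
    (hμ : μ ∈ perturbedGibbsMeasures (d := d) (fundamentalRep (Fin N)) (N * β) W supp)
    (Λ : Finset (ZdEdge d)) (η : LGConfig d (Matrix.specialUnitaryGroup (Fin N) ℂ))
    {F : LGConfig d (Matrix.specialUnitaryGroup (Fin N) ℂ) → ℝ} {Δ : Finset (ZdEdge d)} {K : ℝ≥0}
    (hF : IsLipschitzCylinder (fundamentalRep (Fin N)) F Δ K) {D : ℝ}
    (hD : ∀ y ∈ Δ, ∀ z, z ∉ Λ → D ≤ ‖y.1 - z.1‖) :
    |(∫ U, F U ∂(perturbedYM (d := d) (fundamentalRep (Fin N)) (N * β) W supp Λ η)) - ∫ U, F U ∂μ| ≤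
      2 * Real.sqrt N * K * Δ.card * (max ρ (1 / 2)) ^ ⌊D / max 1 R⌋₊ := by
  haveI : SecondCountableTopology (Matrix (Fin N) (Fin N) ℂ) :=
    inferInstanceAs (SecondCountableTopology (Fin N → Fin N → ℂ))
  haveI : SecondCountableTopology (Matrix.specialUnitaryGroup (Fin N) ℂ) :=
    Topology.IsEmbedding.subtypeVal.secondCountableTopology
  obtain ⟨osc, lip, hosc, hlip, hosca, hΛ⟩ := hmem.loads
  have hW : W.IsAdapted := fun X => ⟨hmem.dependsOn X, (hmem.continuous X).measurable⟩
  have hWb : ∀ X, ∃ C, ∀ U, |W X U| ≤ C := fun X => exists_bound_of_continuous (hmem.continuous X)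
  have hKR := isKRContraction_perturbedYM_SU hd hN hc hv hb hP hVB hW (supp := supp) hosc hosca hlip
  have hrow : ∀ x, ∑ y ∈ perturbedNbr supp x,
      (exp ε₀ * Real.sqrt (c * v) * |β| * linkInfluence x y +
        exp (ε₀ / 2) * Real.sqrt c * ∑ X ∈ (supp {x}).filter (fun X => x ∈ X), lip X y) ≤ ρ :=
    fun x => (sum_perturbedNbr_coeff_le hd (β := β) (c := c) (v := v) (a := ε₀) hΛ x).trans hρ
  exact abs_boundary_sub_integral_le_of_isKRContraction hW hWb hmem.supportedBy hKR hrow hρ1 hmem.range hμ Λ η hF hD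

/-! ### `SU(2)`, hypothesis-free -/

/-- **`SU(2)`, HYPOTHESIS-FREE, every `d ≥ 1`** (sharp one-link Poincaré constant `2/3`, `√(c v) = 4/3`; Wilson units
`β = β_W/4`): if `2(d−1)|β_W| e^{ε₀} + e^{ε₀/2} √(2/3) ε₁ ≤ ρ < 1` then for every member of `MemBallZd ε₀ ε₁ R`, every DLR
state `μ`, every finite link volume `Λ`, every boundary field `η` and every Lipschitz cylinder `F` (constant `K`, links
`Δ` at depth `≥ D` in `Λ`): `|∫ F dγ^W_Λ(· | η) − ∫ F dμ| ≤ 2√2 · K · #Δ · max(ρ,½)^{⌊D / max(1,R)⌋₊}`. [folklore] -/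
theorem su2_abs_boundary_sub_integral_le (hd : 1 ≤ d) {βW ε₀ ε₁ ρ R : ℝ}
    (hρ : 2 * ((d : ℝ) - 1) * |βW| * exp ε₀ + exp (ε₀ / 2) * Real.sqrt (2 / 3) * ε₁ ≤ ρ) (hρ1 : ρ < 1)
    {W : Potential (ZdEdge d) (Matrix.specialUnitaryGroup (Fin 2) ℂ)}
    {supp : Finset (ZdEdge d) → Finset (Finset (ZdEdge d))} (hmem : MemBallZd ε₀ ε₁ R W supp)
    {μ : Measure (LGConfig d (Matrix.specialUnitaryGroup (Fin 2) ℂ))}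
    (hμ : μ ∈ perturbedGibbsMeasures (d := d) (fundamentalRep (Fin 2)) ((2 : ℕ) * (βW / 4)) W supp)
    (Λ : Finset (ZdEdge d)) (η : LGConfig d (Matrix.specialUnitaryGroup (Fin 2) ℂ))
    {F : LGConfig d (Matrix.specialUnitaryGroup (Fin 2) ℂ) → ℝ} {Δ : Finset (ZdEdge d)} {K : ℝ≥0}
    (hF : IsLipschitzCylinder (fundamentalRep (Fin 2)) F Δ K) {D : ℝ}
    (hD : ∀ y ∈ Δ, ∀ z, z ∉ Λ → D ≤ ‖y.1 - z.1‖) :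
    |(∫ U, F U ∂(perturbedYM (d := d) (fundamentalRep (Fin 2)) ((2 : ℕ) * (βW / 4)) W supp Λ η)) - ∫ U, F U ∂μ| ≤
      2 * Real.sqrt 2 * K * Δ.card * (max ρ (1 / 2)) ^ ⌊D / max 1 R⌋₊ := by
  have hc : (0 : ℝ) ≤ 2 / 3 := by norm_num
  have hP : ∀ B : Matrix (Fin 2) (Fin 2) ℂ, matrixOpNorm B ≤ |βW / 4| * (2 * ((d : ℝ) - 1)) →
      ∀ (ψ : Matrix.specialUnitaryGroup (Fin 2) ℂ → ℝ) (M : ℝ), 0 ≤ M →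
        (∀ x y, |ψ x - ψ y| ≤ M * suFrobDist x y) →
        Var[ψ; (haarProbability (Matrix.specialUnitaryGroup (Fin 2) ℂ)).tilted
          fun g => ((2 : ℕ) : ℝ) * ((g : Matrix (Fin 2) (Fin 2) ℂ) * B).trace.re] ≤ 2 / 3 * M ^ 2 :=
    fun B hB ψ M hM hψ => oneLinkPoincareSUN_two_sharp _ B hB ψ M hM hψ
  have hVB := linVariance_of_poincare (N := 2) hP
  have hv : (0 : ℝ) ≤ 2 / 3 * ((2 : ℕ) : ℝ) ^ 2 := by norm_num
  have hsq : Real.sqrt (2 / 3 * (2 / 3 * ((2 : ℕ) : ℝ) ^ 2)) = 4 / 3 := by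
    rw [show (2 / 3 * (2 / 3 * ((2 : ℕ) : ℝ) ^ 2) : ℝ) = (4 / 3) ^ 2 by norm_num, Real.sqrt_sq (by norm_num)]
  have hρ' : 6 * ((d : ℝ) - 1) * |βW / 4| * (exp ε₀ * Real.sqrt (2 / 3 * (2 / 3 * ((2 : ℕ) : ℝ) ^ 2))) +
      exp (ε₀ / 2) * Real.sqrt (2 / 3) * ε₁ ≤ ρ := by
    rw [hsq]
    have e : 6 * ((d : ℝ) - 1) * |βW / 4| * (exp ε₀ * (4 / 3)) = 2 * ((d : ℝ) - 1) * |βW| * exp ε₀ := by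
      rw [abs_div, abs_of_pos (by norm_num : (0 : ℝ) < 4)]
      ring
    rw [e]
    exact hρ
  have h := abs_boundary_sub_integral_le_of_pair hd (by norm_num) (R := R) hc hv le_rfl hP hVB hρ' hρ1 hmem hμ Λ η
    hF hD
  have e2 : Real.sqrt ((2 : ℕ) : ℝ) = Real.sqrt 2 := by norm_num
  rw [e2] at h
  exact h

/-- **The `d = 4` reading for `SU(2)`**: `6|β_W| e^{ε₀} + e^{ε₀/2} √(2/3) ε₁ ≤ ρ < 1` ⇒ on the whole ball `MemBallZd ε₀ ε₁ R`
the finite-volume Gibbs distribution with ANY boundary field approximates every DLR state on Lipschitz cylinders at depth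
`D` to accuracy `2√2 · K · #Δ · max(ρ,½)^{⌊D / max(1,R)⌋₊}`. [folklore] -/
theorem su2_abs_boundary_sub_integral_le_dim4 {βW ε₀ ε₁ ρ R : ℝ}
    (hρ : 6 * |βW| * exp ε₀ + exp (ε₀ / 2) * Real.sqrt (2 / 3) * ε₁ ≤ ρ) (hρ1 : ρ < 1)
    {W : Potential (ZdEdge 4) (Matrix.specialUnitaryGroup (Fin 2) ℂ)}
    {supp : Finset (ZdEdge 4) → Finset (Finset (ZdEdge 4))} (hmem : MemBallZd ε₀ ε₁ R W supp)
    {μ : Measure (LGConfig 4 (Matrix.specialUnitaryGroup (Fin 2) ℂ))}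
    (hμ : μ ∈ perturbedGibbsMeasures (d := 4) (fundamentalRep (Fin 2)) ((2 : ℕ) * (βW / 4)) W supp)
    (Λ : Finset (ZdEdge 4)) (η : LGConfig 4 (Matrix.specialUnitaryGroup (Fin 2) ℂ))
    {F : LGConfig 4 (Matrix.specialUnitaryGroup (Fin 2) ℂ) → ℝ} {Δ : Finset (ZdEdge 4)} {K : ℝ≥0}
    (hF : IsLipschitzCylinder (fundamentalRep (Fin 2)) F Δ K) {D : ℝ}
    (hD : ∀ y ∈ Δ, ∀ z, z ∉ Λ → D ≤ ‖y.1 - z.1‖) :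
    |(∫ U, F U ∂(perturbedYM (d := 4) (fundamentalRep (Fin 2)) ((2 : ℕ) * (βW / 4)) W supp Λ η)) - ∫ U, F U ∂μ| ≤
      2 * Real.sqrt 2 * K * Δ.card * (max ρ (1 / 2)) ^ ⌊D / max 1 R⌋₊ :=
  su2_abs_boundary_sub_integral_le (by norm_num) (by
    have h6 : (2 : ℝ) * (((4 : ℕ) : ℝ) - 1) = 6 := by norm_num
    calc 2 * (((4 : ℕ) : ℝ) - 1) * |βW| * exp ε₀ + exp (ε₀ / 2) * Real.sqrt (2 / 3) * ε₁
        = 6 * |βW| * exp ε₀ + exp (ε₀ / 2) * Real.sqrt (2 / 3) * ε₁ := by rw [h6]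
      _ ≤ ρ := hρ) hρ1 hmem hμ Λ η hF hD

/-- **The clean exponential reading, `SU(2)`, `d = 4`, `1/2 ≤ ρ < 1`, `D ≥ 0`**: penetration rate `(1 − ρ)/max(1,R)`,
constant `4√2 · K · #Δ` (`−log ρ ≥ 1 − ρ`, `1/ρ ≤ 2`):
`|∫ F dγ^W_Λ(· | η) − ∫ F dμ| ≤ 4√2 · K · #Δ · e^{−((1−ρ)/max(1,R)) D}`. [folklore] -/
theorem su2_abs_boundary_sub_integral_le_dim4_exp {βW ε₀ ε₁ ρ R : ℝ}
    (hρ : 6 * |βW| * exp ε₀ + exp (ε₀ / 2) * Real.sqrt (2 / 3) * ε₁ ≤ ρ) (hhalf : 1 / 2 ≤ ρ) (hρ1 : ρ < 1)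
    {W : Potential (ZdEdge 4) (Matrix.specialUnitaryGroup (Fin 2) ℂ)}
    {supp : Finset (ZdEdge 4) → Finset (Finset (ZdEdge 4))} (hmem : MemBallZd ε₀ ε₁ R W supp)
    {μ : Measure (LGConfig 4 (Matrix.specialUnitaryGroup (Fin 2) ℂ))}
    (hμ : μ ∈ perturbedGibbsMeasures (d := 4) (fundamentalRep (Fin 2)) ((2 : ℕ) * (βW / 4)) W supp)
    (Λ : Finset (ZdEdge 4)) (η : LGConfig 4 (Matrix.specialUnitaryGroup (Fin 2) ℂ))
    {F : LGConfig 4 (Matrix.specialUnitaryGroup (Fin 2) ℂ) → ℝ} {Δ : Finset (ZdEdge 4)} {K : ℝ≥0}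
    (hF : IsLipschitzCylinder (fundamentalRep (Fin 2)) F Δ K) {D : ℝ} (hD0 : 0 ≤ D)
    (hD : ∀ y ∈ Δ, ∀ z, z ∉ Λ → D ≤ ‖y.1 - z.1‖) :
    |(∫ U, F U ∂(perturbedYM (d := 4) (fundamentalRep (Fin 2)) ((2 : ℕ) * (βW / 4)) W supp Λ η)) - ∫ U, F U ∂μ| ≤
      4 * Real.sqrt 2 * K * Δ.card * exp (-((1 - ρ) / max 1 R) * D) := by
  have h := su2_abs_boundary_sub_integral_le_dim4 hρ hρ1 hmem hμ Λ η hF hD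
  have hρ0 : 0 < ρ := by linarith
  have hmax : max ρ (1 / 2) = ρ := max_eq_left hhalf
  rw [hmax] at h
  have hR₀0 : 0 < max 1 R := zero_lt_one.trans_le (le_max_left _ _)
  have hK : (0 : ℝ) ≤ K := K.2
  -- `ρ^{⌊D/R₀⌋₊} ≤ e^{κ} e^{−κ D/R₀} ≤ 2 e^{−(1−ρ) D/R₀}`
  have hgeom := pow_natFloor_le_exp_mul_exp hρ0 hρ1.le (D / max 1 R)
  have hexpκ : exp (-Real.log ρ) ≤ 2 := by
    rw [Real.exp_neg, Real.exp_log hρ0, inv_le_comm₀ hρ0 (by norm_num : (0 : ℝ) < 2)]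
    linarith
  have hκ : 1 - ρ ≤ -Real.log ρ := by
    have := Real.log_le_sub_one_of_pos hρ0
    linarith
  have hexp2 : exp (-(-Real.log ρ) * (D / max 1 R)) ≤ exp (-((1 - ρ) / max 1 R) * D) := by
    refine exp_le_exp.2 ?_
    have hDR : 0 ≤ D / max 1 R := div_nonneg hD0 hR₀0.le
    have e : -((1 - ρ) / max 1 R) * D = -(1 - ρ) * (D / max 1 R) := by field_simp
    rw [e]
    nlinarith
  calc |(∫ U, F U ∂(perturbedYM (d := 4) (fundamentalRep (Fin 2)) ((2 : ℕ) * (βW / 4)) W supp Λ η)) - ∫ U, F U ∂μ|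
      ≤ 2 * Real.sqrt 2 * K * Δ.card * ρ ^ ⌊D / max 1 R⌋₊ := h
    _ ≤ 2 * Real.sqrt 2 * K * Δ.card * (2 * exp (-((1 - ρ) / max 1 R) * D)) := by
        refine mul_le_mul_of_nonneg_left (hgeom.trans ?_) (by positivity)
        exact mul_le_mul hexpκ hexp2 (by positivity) (by norm_num)
    _ = 4 * Real.sqrt 2 * K * Δ.card * exp (-((1 - ρ) / max 1 R) * D) := by ring

/-! ### Numeric rows (`ℤ⁴`, one-parameter ball `(ε₀, ε₁) = (2ε, ε)`) and named cells -/

/-- **Boundary row, lineage (A), from the numeric majorants** (`T` = `exp_le_taylor4`, `√(2/3) ≤ 0.8165`): for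
`0 ≤ β_W`, `0 ≤ ε ≤ 1/2` and `6 β_W T(2ε) + T(ε)·0.8165·ε ≤ ρ < 1`, on `MemBallZd (2ε) ε R` at `β_W` every finite-volume
Gibbs distribution with any boundary field is within `2√2 · K · #Δ · max(ρ,½)^{⌊D/max(1,R)⌋₊}` of every DLR state on
Lipschitz cylinders at depth `D`. [folklore] -/
theorem su2_boundaryRowA {βW ε ρ R : ℝ} (hβ : 0 ≤ βW) (hε0 : 0 ≤ ε) (hε1 : ε ≤ 1 / 2)
    (h : 6 * βW * (1 + 2 * ε + (2 * ε) ^ 2 / 2 + (2 * ε) ^ 3 / 6 + 5 / 96 * (2 * ε) ^ 4) +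
      (1 + ε + ε ^ 2 / 2 + ε ^ 3 / 6 + 5 / 96 * ε ^ 4) * (8165 / 10000) * ε ≤ ρ) (hρ1 : ρ < 1)
    {W : Potential (ZdEdge 4) (Matrix.specialUnitaryGroup (Fin 2) ℂ)}
    {supp : Finset (ZdEdge 4) → Finset (Finset (ZdEdge 4))} (hmem : MemBallZd (2 * ε) ε R W supp)
    {μ : Measure (LGConfig 4 (Matrix.specialUnitaryGroup (Fin 2) ℂ))}
    (hμ : μ ∈ perturbedGibbsMeasures (d := 4) (fundamentalRep (Fin 2)) ((2 : ℕ) * (βW / 4)) W supp)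
    (Λ : Finset (ZdEdge 4)) (η : LGConfig 4 (Matrix.specialUnitaryGroup (Fin 2) ℂ))
    {F : LGConfig 4 (Matrix.specialUnitaryGroup (Fin 2) ℂ) → ℝ} {Δ : Finset (ZdEdge 4)} {K : ℝ≥0}
    (hF : IsLipschitzCylinder (fundamentalRep (Fin 2)) F Δ K) {D : ℝ}
    (hD : ∀ y ∈ Δ, ∀ z, z ∉ Λ → D ≤ ‖y.1 - z.1‖) :
    |(∫ U, F U ∂(perturbedYM (d := 4) (fundamentalRep (Fin 2)) ((2 : ℕ) * (βW / 4)) W supp Λ η)) - ∫ U, F U ∂μ| ≤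
      2 * Real.sqrt 2 * K * Δ.card * (max ρ (1 / 2)) ^ ⌊D / max 1 R⌋₊ := by
  refine su2_abs_boundary_sub_integral_le_dim4 ?_ hρ1 hmem hμ Λ η hF hD
  have h1 := exp_le_taylor4 (x := 2 * ε) (by linarith) (by linarith)
  have h2 := exp_le_taylor4 (x := ε) hε0 (by linarith)
  rw [abs_of_nonneg hβ, show 2 * ε / 2 = ε by ring]
  calc 6 * βW * exp (2 * ε) + exp ε * Real.sqrt (2 / 3) * ε
      ≤ 6 * βW * (1 + 2 * ε + (2 * ε) ^ 2 / 2 + (2 * ε) ^ 3 / 6 + 5 / 96 * (2 * ε) ^ 4) +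
        (1 + ε + ε ^ 2 / 2 + ε ^ 3 / 6 + 5 / 96 * ε ^ 4) * (8165 / 10000) * ε := by
        gcongr
        · exact sqrt_two_thirds_le
    _ ≤ ρ := h

/-- **Cell `(β_W, ε) = (1/8, 1/20)`**: on `MemBallZd (1/10) (1/20) R` at `β_W = 1/8`, for every member, every DLR state,
every volume and every boundary field: `|∫ F dγ^W_Λ(·|η) − ∫ F dμ| ≤ 2√2 · K · #Δ · (7/8)^{⌊D/max(1,R)⌋₊}`. [folklore] -/
theorem su2_boundaryRowA_1_8 {R : ℝ} {W : Potential (ZdEdge 4) (Matrix.specialUnitaryGroup (Fin 2) ℂ)}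
    {supp : Finset (ZdEdge 4) → Finset (Finset (ZdEdge 4))} (hmem : MemBallZd (2 * (1 / 20)) (1 / 20) R W supp)
    {μ : Measure (LGConfig 4 (Matrix.specialUnitaryGroup (Fin 2) ℂ))}
    (hμ : μ ∈ perturbedGibbsMeasures (d := 4) (fundamentalRep (Fin 2)) ((2 : ℕ) * ((1 / 8 : ℝ) / 4)) W supp)
    (Λ : Finset (ZdEdge 4)) (η : LGConfig 4 (Matrix.specialUnitaryGroup (Fin 2) ℂ))
    {F : LGConfig 4 (Matrix.specialUnitaryGroup (Fin 2) ℂ) → ℝ} {Δ : Finset (ZdEdge 4)} {K : ℝ≥0}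
    (hF : IsLipschitzCylinder (fundamentalRep (Fin 2)) F Δ K) {D : ℝ}
    (hD : ∀ y ∈ Δ, ∀ z, z ∉ Λ → D ≤ ‖y.1 - z.1‖) :
    |(∫ U, F U ∂(perturbedYM (d := 4) (fundamentalRep (Fin 2)) ((2 : ℕ) * ((1 / 8 : ℝ) / 4)) W supp Λ η)) -
        ∫ U, F U ∂μ| ≤ 2 * Real.sqrt 2 * K * Δ.card * (7 / 8 : ℝ) ^ ⌊D / max 1 R⌋₊ := by
  have h := su2_boundaryRowA (ρ := 7 / 8) (by norm_num) (by norm_num) (by norm_num) (by norm_num) (by norm_num) hmem hμ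
    Λ η hF hD
  rwa [show max (7 / 8 : ℝ) (1 / 2) = 7 / 8 by norm_num] at h

/-- **Cell `(β_W, ε) = (1/10, 1/10)`**: on `MemBallZd (1/5) (1/10) R` at `β_W = 1/10`: `… ≤ 2√2 · K · #Δ · (7/8)^{⌊D/max(1,R)⌋₊}`.
[folklore] -/
theorem su2_boundaryRowA_1_10 {R : ℝ} {W : Potential (ZdEdge 4) (Matrix.specialUnitaryGroup (Fin 2) ℂ)}
    {supp : Finset (ZdEdge 4) → Finset (Finset (ZdEdge 4))} (hmem : MemBallZd (2 * (1 / 10)) (1 / 10) R W supp)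
    {μ : Measure (LGConfig 4 (Matrix.specialUnitaryGroup (Fin 2) ℂ))}
    (hμ : μ ∈ perturbedGibbsMeasures (d := 4) (fundamentalRep (Fin 2)) ((2 : ℕ) * ((1 / 10 : ℝ) / 4)) W supp)
    (Λ : Finset (ZdEdge 4)) (η : LGConfig 4 (Matrix.specialUnitaryGroup (Fin 2) ℂ))
    {F : LGConfig 4 (Matrix.specialUnitaryGroup (Fin 2) ℂ) → ℝ} {Δ : Finset (ZdEdge 4)} {K : ℝ≥0}
    (hF : IsLipschitzCylinder (fundamentalRep (Fin 2)) F Δ K) {D : ℝ}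
    (hD : ∀ y ∈ Δ, ∀ z, z ∉ Λ → D ≤ ‖y.1 - z.1‖) :
    |(∫ U, F U ∂(perturbedYM (d := 4) (fundamentalRep (Fin 2)) ((2 : ℕ) * ((1 / 10 : ℝ) / 4)) W supp Λ η)) -
        ∫ U, F U ∂μ| ≤ 2 * Real.sqrt 2 * K * Δ.card * (7 / 8 : ℝ) ^ ⌊D / max 1 R⌋₊ := by
  have h := su2_boundaryRowA (ρ := 7 / 8) (by norm_num) (by norm_num) (by norm_num) (by norm_num) (by norm_num) hmem hμ
    Λ η hF hD
  rwa [show max (7 / 8 : ℝ) (1 / 2) = 7 / 8 by norm_num] at h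

/-- **Cell `(β_W, ε) = (1/16, 1/20)`**: on `MemBallZd (1/10) (1/20) R` at `β_W = 1/16` (row sum `≤ 1/2`):
`… ≤ 2√2 · K · #Δ · (1/2)^{⌊D/max(1,R)⌋₊}`. [folklore] -/
theorem su2_boundaryRowA_1_16 {R : ℝ} {W : Potential (ZdEdge 4) (Matrix.specialUnitaryGroup (Fin 2) ℂ)}
    {supp : Finset (ZdEdge 4) → Finset (Finset (ZdEdge 4))} (hmem : MemBallZd (2 * (1 / 20)) (1 / 20) R W supp)
    {μ : Measure (LGConfig 4 (Matrix.specialUnitaryGroup (Fin 2) ℂ))}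
    (hμ : μ ∈ perturbedGibbsMeasures (d := 4) (fundamentalRep (Fin 2)) ((2 : ℕ) * ((1 / 16 : ℝ) / 4)) W supp)
    (Λ : Finset (ZdEdge 4)) (η : LGConfig 4 (Matrix.specialUnitaryGroup (Fin 2) ℂ))
    {F : LGConfig 4 (Matrix.specialUnitaryGroup (Fin 2) ℂ) → ℝ} {Δ : Finset (ZdEdge 4)} {K : ℝ≥0}
    (hF : IsLipschitzCylinder (fundamentalRep (Fin 2)) F Δ K) {D : ℝ}
    (hD : ∀ y ∈ Δ, ∀ z, z ∉ Λ → D ≤ ‖y.1 - z.1‖) :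
    |(∫ U, F U ∂(perturbedYM (d := 4) (fundamentalRep (Fin 2)) ((2 : ℕ) * ((1 / 16 : ℝ) / 4)) W supp Λ η)) -
        ∫ U, F U ∂μ| ≤ 2 * Real.sqrt 2 * K * Δ.card * (1 / 2 : ℝ) ^ ⌊D / max 1 R⌋₊ := by
  have h := su2_boundaryRowA (ρ := 1 / 2) (by norm_num) (by norm_num) (by norm_num) (by norm_num) (by norm_num) hmem hμ
    Λ η hF hD
  rwa [max_self] at h

/-! ### The Wilson point: boundary insensitivity of `SU(2)` lattice Yang–Mills on `ℤ⁴` at an explicit rate -/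

/-- **THE WILSON POINT**: for `0 ≤ β_W ≤ 1/12`, EVERY DLR state `μ` of `SU(2)` lattice Yang–Mills on `ℤ⁴` (tree coupling
`β_W/2`, 't Hooft `β_W/4`) and every finite-volume Wilson distribution `γ_Λ(· | η)` with ANY boundary field `η` satisfy,
for every Lipschitz cylinder `F` (constant `K`, links `Δ` at depth `≥ D` in `Λ`):
`|∫ F dγ_Λ(· | η) − ∫ F dμ| ≤ 2√2 · K · #Δ · (1/2)^{⌊D⌋₊}` — the boundary is forgotten at rate `log 2` per lattice unit
(row sum `6β_W ≤ 1/2`, the zero member of the ball). [folklore] -/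
theorem su2_wilson_boundary_upTo_oneTwelfth {βW : ℝ} (h0 : 0 ≤ βW) (h : βW ≤ 1 / 12)
    {μ : Measure (LGConfig 4 (Matrix.specialUnitaryGroup (Fin 2) ℂ))}
    (hμ : μ ∈ ymGibbsMeasures (d := 4) (fundamentalRep (Fin 2)) (βW / 2))
    (Λ : Finset (ZdEdge 4)) (η : LGConfig 4 (Matrix.specialUnitaryGroup (Fin 2) ℂ))
    {F : LGConfig 4 (Matrix.specialUnitaryGroup (Fin 2) ℂ) → ℝ} {Δ : Finset (ZdEdge 4)} {K : ℝ≥0}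
    (hF : IsLipschitzCylinder (fundamentalRep (Fin 2)) F Δ K) {D : ℝ}
    (hD : ∀ y ∈ Δ, ∀ z, z ∉ Λ → D ≤ ‖y.1 - z.1‖) :
    |(∫ U, F U ∂(ymSpecification (d := 4) (fundamentalRep (Fin 2)) (βW / 2) Λ η)) - ∫ U, F U ∂μ| ≤
      2 * Real.sqrt 2 * K * Δ.card * (1 / 2 : ℝ) ^ ⌊D⌋₊ := by
  have hβ : (((2 : ℕ) : ℝ) * (βW / 4) : ℝ) = βW / 2 := by push_cast; ring
  have hmem : MemBallZd (N := 2) (0 : ℝ) 0 0 (0 : Potential (ZdEdge 4) (Matrix.specialUnitaryGroup (Fin 2) ℂ))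
      (fun _ => (∅ : Finset (Finset (ZdEdge 4)))) :=
    memBallZd_zero le_rfl le_rfl fun _ _ h => by simp at h
  have hμ' : μ ∈ perturbedGibbsMeasures (d := 4) (fundamentalRep (Fin 2)) ((2 : ℕ) * (βW / 4)) 0
      (fun _ => (∅ : Finset (Finset (ZdEdge 4)))) := by
    rwa [perturbedGibbsMeasures_zero, hβ]
  have key := su2_abs_boundary_sub_integral_le_dim4 (ρ := 1 / 2) (ε₀ := 0) (ε₁ := 0) (by
      rw [abs_of_nonneg h0, Real.exp_zero, zero_div, Real.exp_zero]
      linarith) (by norm_num) hmem hμ' Λ η hF hD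
  rw [perturbedYM_zero, hβ, max_self, max_eq_left (zero_le_one : (0 : ℝ) ≤ 1), div_one] at key
  exact key

/-- The same for `1/12 ≤ β_W < 1/6` with the geometric ratio `6β_W` (row sum `6β_W ≥ 1/2`):
`|∫ F dγ_Λ(· | η) − ∫ F dμ| ≤ 2√2 · K · #Δ · (6β_W)^{⌊D⌋₊}` for every DLR state, volume and boundary field. [folklore] -/
theorem su2_wilson_boundary_lt_oneSixth {βW : ℝ} (h0 : 1 / 12 ≤ βW) (h : βW < 1 / 6)
    {μ : Measure (LGConfig 4 (Matrix.specialUnitaryGroup (Fin 2) ℂ))}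
    (hμ : μ ∈ ymGibbsMeasures (d := 4) (fundamentalRep (Fin 2)) (βW / 2))
    (Λ : Finset (ZdEdge 4)) (η : LGConfig 4 (Matrix.specialUnitaryGroup (Fin 2) ℂ))
    {F : LGConfig 4 (Matrix.specialUnitaryGroup (Fin 2) ℂ) → ℝ} {Δ : Finset (ZdEdge 4)} {K : ℝ≥0}
    (hF : IsLipschitzCylinder (fundamentalRep (Fin 2)) F Δ K) {D : ℝ}
    (hD : ∀ y ∈ Δ, ∀ z, z ∉ Λ → D ≤ ‖y.1 - z.1‖) :
    |(∫ U, F U ∂(ymSpecification (d := 4) (fundamentalRep (Fin 2)) (βW / 2) Λ η)) - ∫ U, F U ∂μ| ≤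
      2 * Real.sqrt 2 * K * Δ.card * (6 * βW) ^ ⌊D⌋₊ := by
  have hβ : (((2 : ℕ) : ℝ) * (βW / 4) : ℝ) = βW / 2 := by push_cast; ring
  have hmem : MemBallZd (N := 2) (0 : ℝ) 0 0 (0 : Potential (ZdEdge 4) (Matrix.specialUnitaryGroup (Fin 2) ℂ))
      (fun _ => (∅ : Finset (Finset (ZdEdge 4)))) :=
    memBallZd_zero le_rfl le_rfl fun _ _ h => by simp at h
  have hμ' : μ ∈ perturbedGibbsMeasures (d := 4) (fundamentalRep (Fin 2)) ((2 : ℕ) * (βW / 4)) 0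
      (fun _ => (∅ : Finset (Finset (ZdEdge 4)))) := by
    rwa [perturbedGibbsMeasures_zero, hβ]
  have key := su2_abs_boundary_sub_integral_le_dim4 (ρ := 6 * βW) (ε₀ := 0) (ε₁ := 0) (by
      rw [abs_of_nonneg (by linarith), Real.exp_zero, zero_div, Real.exp_zero]
      linarith) (by linarith) hmem hμ' Λ η hF hD
  rw [perturbedYM_zero, hβ, max_eq_left (by linarith : (1 / 2 : ℝ) ≤ 6 * βW),
    max_eq_left (zero_le_one : (0 : ℝ) ≤ 1), div_one] at key
  exact key

/-! ### Every `N ≥ 2`: the Bakry–Émery pair, hypothesis-free -/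

/-- **ALL `N ≥ 2`, EVERY `d ≥ 1`, HYPOTHESIS-FREE — boundary insensitivity uniformly on the tier-1 ball from the
Bakry–Émery one-link pair** (`oneLinkPoincareSUN_bakryEmery`, `oneLinkVarianceBound_bakryEmery`; `b = 2(d−1)|β| < 1/2`):
`6(d−1)|β| e^{ε₀}/(1/2 − b) + e^{ε₀/2} ε₁/√(N(1/2 − b)) ≤ ρ < 1` ⇒ for every member of `MemBallZd ε₀ ε₁ R`, every DLR
state, volume, boundary field and Lipschitz cylinder at depth `D`:
`|∫ F dγ^W_Λ(·|η) − ∫ F dμ| ≤ 2√N · K · #Δ · max(ρ,½)^{⌊D/max(1,R)⌋₊}`. [folklore] -/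
theorem suN_abs_boundary_sub_integral_le_bakryEmery (hd : 1 ≤ d) (hN : 2 ≤ N) {β ε₀ ε₁ ρ R : ℝ}
    (hb : |β| * (2 * ((d : ℝ) - 1)) < 1 / 2)
    (hρ : 6 * ((d : ℝ) - 1) * |β| * exp ε₀ / (1 / 2 - |β| * (2 * ((d : ℝ) - 1))) +
      exp (ε₀ / 2) * ε₁ / Real.sqrt ((N : ℝ) * (1 / 2 - |β| * (2 * ((d : ℝ) - 1)))) ≤ ρ) (hρ1 : ρ < 1)
    {W : Potential (ZdEdge d) (Matrix.specialUnitaryGroup (Fin N) ℂ)}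
    {supp : Finset (ZdEdge d) → Finset (Finset (ZdEdge d))} (hmem : MemBallZd ε₀ ε₁ R W supp)
    {μ : Measure (LGConfig d (Matrix.specialUnitaryGroup (Fin N) ℂ))}
    (hμ : μ ∈ perturbedGibbsMeasures (d := d) (fundamentalRep (Fin N)) (N * β) W supp)
    (Λ : Finset (ZdEdge d)) (η : LGConfig d (Matrix.specialUnitaryGroup (Fin N) ℂ))
    {F : LGConfig d (Matrix.specialUnitaryGroup (Fin N) ℂ) → ℝ} {Δ : Finset (ZdEdge d)} {K : ℝ≥0}
    (hF : IsLipschitzCylinder (fundamentalRep (Fin N)) F Δ K) {D : ℝ}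
    (hD : ∀ y ∈ Δ, ∀ z, z ∉ Λ → D ≤ ‖y.1 - z.1‖) :
    |(∫ U, F U ∂(perturbedYM (d := d) (fundamentalRep (Fin N)) (N * β) W supp Λ η)) - ∫ U, F U ∂μ| ≤
      2 * Real.sqrt N * K * Δ.card * (max ρ (1 / 2)) ^ ⌊D / max 1 R⌋₊ := by
  set b : ℝ := |β| * (2 * ((d : ℝ) - 1)) with hbdef
  have hNpos : (0 : ℝ) < N := by exact_mod_cast (show 0 < N by omega)
  have hgap : 0 < 1 / 2 - b := by linarith
  have hP := oneLinkPoincareSUN_bakryEmery hN hb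
  have hV := oneLinkVarianceBound_bakryEmery hN hb
  have hc : (0 : ℝ) ≤ 1 / ((N : ℝ) * (1 / 2 - b)) := by positivity
  have hv : (0 : ℝ) ≤ (N : ℝ) / (1 / 2 - b) := by positivity
  refine abs_boundary_sub_integral_le_of_pair hd (by omega) hc hv le_rfl (fun B hB => hP B hB)
    (fun B hB => hV B hB) ?_ hρ1 hmem hμ Λ η hF hD
  have hsq1 : Real.sqrt (1 / ((N : ℝ) * (1 / 2 - b)) * ((N : ℝ) / (1 / 2 - b))) = 1 / (1 / 2 - b) := by
    rw [show 1 / ((N : ℝ) * (1 / 2 - b)) * ((N : ℝ) / (1 / 2 - b)) = (1 / (1 / 2 - b)) ^ 2 by field_simp,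
      Real.sqrt_sq (by positivity)]
  have hsq2 : Real.sqrt (1 / ((N : ℝ) * (1 / 2 - b))) = 1 / Real.sqrt ((N : ℝ) * (1 / 2 - b)) := by
    rw [Real.sqrt_div' _ (mul_nonneg hNpos.le hgap.le), Real.sqrt_one]
  rw [hsq1, hsq2]
  calc 6 * ((d : ℝ) - 1) * |β| * (exp ε₀ * (1 / (1 / 2 - b))) + exp (ε₀ / 2) * (1 / Real.sqrt ((N : ℝ) * (1 / 2 - b))) * ε₁
      = 6 * ((d : ℝ) - 1) * |β| * exp ε₀ / (1 / 2 - b) + exp (ε₀ / 2) * ε₁ / Real.sqrt ((N : ℝ) * (1 / 2 - b)) := by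
        ring
    _ ≤ ρ := hρ

end Summit.Ventures.YMGap.RobustBall

end
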